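import Summits.QuantumFields.YangMills.Theorems.AllWindowsColdBoxBoxHighLineEventInsideFPSharp
import Summits.QuantumFields.YangMills.Theorems.AllWindowsColdBoxBoxHighLineCubicCutInsideFP

/-!
# `CubicCutInsideFP`, sharp form (planner ym-idea-2 g18 (N1), ASSEMBLY-U5 v0.1 §3 (D′)): the cubic cut with a CONSTANT bracket in the regime `s·H⁴ ≤ c₀`
# (LINE-20 U5 ⟨stmt-QuantumFields-24336⟩; U5 prep, helper-grade; U5 OPEN)

Width seat `ym-line-sfw-p2-w4` (prover-ym-line-sfw-p2-w4-g29-0).  The one-liner over ✓`SmallFieldFPSharp.eventInsideFP_sharp` (w4 g29) at the cubic-cut event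
`E = {λ + C₅βH⁴s⁵ ≤ |cubicVertex β H ·|}` with w5 g23's ✓`EdgeChartGaussian.gaussAvg_sfInd_mul_indicator_cubicVertex_le` at every Gaussian level
`β′ ∈ [β/2, 2β]` (✓`SmallFieldFP.cubicCut_event_rescale`, ✓`tail_rescale_le`), exactly as ✓`SmallFieldFP.cubicCutInsideFP` but with the constant bracket and `√p_k`:

  ★ **`SmallFieldFPSharp.cubicCutInsideFP_sharp`**: with `p_k := (2k−1)^{3k}·(8C₅·H⁴(1+log H)³/β)^k/λ^{2k} ≤ c₁`,
  `∫_{smallField s ∩ E} w_J ≤ C·√p_k·∫_{smallField (s/2) ∖ E} w_J` (`H ≥ 1`, `β > 0`, `0 < s ≤ r`, `s·H² ≤ c₀`, `C(1+log H) ≤ βs²`, `s·H⁴ ≤ c₀`, `λ > 0`, `k ≥ 1`).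

In U5 letters (`s = β^{−1/2+κ₃}`, (K4) `κ₃ + 4θ < 1/2`, `λ = 1`) a FIXED `k` gives `√p_k ≍ β^{−k(1−4θ)/2}·polylog`.  Everything proved; no definitions; standard axioms.
HONEST LABEL: U5 prep, helper-grade; U5 ⟨24336⟩, ⟨24004⟩ and the seat's own crux ⟨22884⟩ remain OPEN; no stub is closed by name, no crux, rung or summit is proved;
**the Yang–Mills mass gap is NOT proved by this file; no summit is proved by a line.**
-/

set_option autoImplicit false

open MeasureTheory Real Finset

namespace Summit.QuantumFields.YangMills.Theorems.AllWindowsColdBoxBoxHighLine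

namespace SmallFieldFPSharp

open SmallFieldFP

variable {H : ℕ}

/-- ★ **`CubicCutInsideFP`, sharp form.** -/
theorem cubicCutInsideFP_sharp :
    ∃ C C₅ c₀ c₁ : ℝ, 0 < c₀ ∧ 0 < c₁ ∧ 0 ≤ C₅ ∧ ∀ H : ℕ, 1 ≤ H → ∀ β r s : ℝ, 0 < β → 0 < s → s ≤ r → s * (H : ℝ) ^ 2 ≤ c₀ →
      C * (1 + Real.log H) ≤ β * s ^ 2 → s * (H : ℝ) ^ 4 ≤ c₀ → ∀ lam : ℝ, 0 < lam → ∀ k : ℕ, 1 ≤ k →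
      (2 * k - 1 : ℝ) ^ (k * 3) * (8 * (C₅ * (H : ℝ) ^ 4 * (1 + Real.log H) ^ 3) / β) ^ k / lam ^ (2 * k) ≤ c₁ →
        ∫ a in smallField H s ∩ {a | lam + C₅ * β * (H : ℝ) ^ 4 * s ^ 5 ≤ |cubicVertex β H a|}, fpChartWeight β H r a ≤
          C * Real.sqrt ((2 * k - 1 : ℝ) ^ (k * 3) * (8 * (C₅ * (H : ℝ) ^ 4 * (1 + Real.log H) ^ 3) / β) ^ k / lam ^ (2 * k)) *
            ∫ a in smallField H (s / 2) \ {a | lam + C₅ * β * (H : ℝ) ^ 4 * s ^ 5 ≤ |cubicVertex β H a|}, fpChartWeight β H r a := by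
  obtain ⟨C, c₀, c₁, hc₀, hc₁, hE⟩ := eventInsideFP_sharp
  obtain ⟨C₅, hC₅, h5⟩ := EdgeChartGaussian.gaussAvg_sfInd_mul_indicator_cubicVertex_le
  refine ⟨C, C₅, c₀, c₁, hc₀, hc₁, hC₅, ?_⟩
  intro H hH β r s hβ hs hsr hsH hCβ hsH4 lam hlam k hk hp
  set E : Set (LandauFree H → E3) := {a | lam + C₅ * β * (H : ℝ) ^ 4 * s ^ 5 ≤ |cubicVertex β H a|} with hEdef
  set p : ℝ := (2 * k - 1 : ℝ) ^ (k * 3) * (8 * (C₅ * (H : ℝ) ^ 4 * (1 + Real.log H) ^ 3) / β) ^ k / lam ^ (2 * k) with hpdef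
  have hEm : MeasurableSet E := measurableSet_cubicCut β C₅ s lam
  have hAm : MeasurableSet (smallField H s ∩ E) := (ChartGauss.measurableSet_smallField s).inter hEm
  have hH' : (1 : ℝ) ≤ H := by exact_mod_cast hH
  have hlog := Real.log_nonneg hH'
  have hp0 : 0 ≤ p := by
    have hk0 : 0 ≤ (2 * k - 1 : ℝ) ^ (k * 3) := by
      have : (1 : ℝ) ≤ 2 * k - 1 := by
        have : (1 : ℝ) ≤ k := by exact_mod_cast hk
        linarith
      positivity
    rw [hpdef]; positivity
  have hgauss : ∀ β' : ℝ, β / 2 ≤ β' → β' ≤ 2 * β → gaussAvg β' H ((smallField H s ∩ E).indicator fun _ => (1 : ℝ)) ≤ p := by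
    intro β' hlo hhi
    have hβ' : 0 < β' := lt_of_lt_of_le (by linarith) hlo
    have hlam' : 0 < β' / β * lam := mul_pos (div_pos hβ' hβ) hlam
    have h := h5 H hH β' hβ' s hs.le (β' / β * lam) hlam' k hk
    rw [← cubicCut_event_rescale hβ hβ'] at h
    have hfun : ((smallField H s ∩ E).indicator fun _ => (1 : ℝ)) = fun a => sfInd H s a * E.indicator (fun _ => (1 : ℝ)) a := by
      funext a
      rw [← Set.indicator_indicator]
      unfold sfInd
      by_cases h1 : a ∈ smallField H s
      · rw [Set.indicator_of_mem h1, Set.indicator_of_mem h1, one_mul]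
      · rw [Set.indicator_of_notMem h1, Set.indicator_of_notMem h1, zero_mul]
    rw [hfun]
    refine h.trans ?_
    have hX : 0 ≤ C₅ * (H : ℝ) ^ 4 * (1 + Real.log H) ^ 3 := by positivity
    have hk0 : 0 ≤ (2 * k - 1 : ℝ) ^ (k * 3) := by
      have : (1 : ℝ) ≤ 2 * k - 1 := by
        have : (1 : ℝ) ≤ k := by exact_mod_cast hk
        linarith
      positivity
    exact tail_rescale_le k hk0 hX hβ hlam hlo
  have hmain := hE H hH β r s hβ hs hsr hsH hCβ hsH4 (smallField H s ∩ E) hAm p hp0 hp hgauss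
  have hset1 : smallField H s ∩ (smallField H s ∩ E) = smallField H s ∩ E := by
    rw [← Set.inter_assoc, Set.inter_self]
  have hset2 : smallField H (s / 2) \ (smallField H s ∩ E) = smallField H (s / 2) \ E := by
    ext a
    simp only [Set.mem_sdiff, Set.mem_inter_iff, not_and]
    constructor
    · rintro ⟨ha, hne⟩
      exact ⟨ha, hne fun e => (ha e).trans (by linarith)⟩
    · rintro ⟨ha, hne⟩
      exact ⟨ha, fun _ => hne⟩
  rw [hset1, hset2] at hmain
  exact hmain

end SmallFieldFPSharp

end Summit.QuantumFields.YangMills.Theorems.AllWindowsColdBoxBoxHighLine
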